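import Literature.NumberTheory.Automorphic.UnitaryGroupLineKAverageArchSmoothTwo
import HarnessLib

/-!
# The line function `t ↦ ∫_K f(k⁻¹ (z n(θ t)) k) dμK` of `U(J₂)` is a Schwartz–Bruhat function on `𝔸_F`
(Rogawski, *Automorphic Representations of Unitary Groups in Three Variables* (1990), §7.3, Prop. 7.3.1 (pp. 97–98): the function `ψ^K` of
the unipotent term of `U(2)`, fed into the Tate integrals over `F^* N𝕀_E ∖ 𝕀_F`; Weil, *Basic Number Theory*, Ch. VII §2)

Topic `NumberTheory/Automorphic`; namespace `Literature.NumberTheory.Automorphic.UnitaryGroup`. THEOREMS ONLY over accepted tree modules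
(no definition, no named fact, no instance, no notation, no `sorry`). FILE 2 of the H-side row (σ-u) «`LineKAverageSchwartzBruhatTwo`» of
`CENSUS-LAWS-Hside` (cell `pub/hodgecm-mathlib`, crux H413); letters of FILE 1 ★ `UnitaryGroupLineKAverageArchSmoothTwo` (`n`, `θ`, `z`, `K`,
`μK`, `f`).

* **`lineKAverage_mem_schwartzBruhatAdele_two`** — `t ↦ ∫_K f(k⁻¹ (z n(θ t)) k) dμK ∈ Meyer.schwartzBruhatAdele F`: Weil's criterion ★
  `Meyer.mem_schwartzBruhatAdele_of_level (K := F)` with (a) support and (hcs) from ★ `exists_isCompact_lineKernel_conj_support_two`, (b) the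
  level from the tube lemma ★ `exists_levelIdeal_forall_conj_line_traceZeroLine_mem_two` (`θ` additive, `n(b + b′) = n(b) n(b′)`, the
  conjugates `k⁻¹ n(θ(0,δ′)) k` have trivial archimedean part and lie in the finite level of `f`), (c) = ★ `contDiff_lineKAverage_two`.

## References

* J. D. Rogawski, *Automorphic Representations of Unitary Groups in Three Variables*, Ann. of Math. Stud. 123 (1990), §7.3
  Prop. 7.3.1 (pp. 97–98) [Rogawski1990].
* A. Weil, *Basic Number Theory*, Grundlehren 144 (1967), Ch. VII §2 [WeilBNT1967].
-/

set_option autoImplicit false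

noncomputable section

open MeasureTheory NumberField NumberField.mixedEmbedding IsDedekindDomain Set Topology Filter Function
-- `Classical` is needed to see the Mathlib normed-space instances on `mixedSpace E` (note H5 of `AdelicGLnGlue`)
open scoped ContDiff Classical MatrixGroups Matrix

namespace Literature.NumberTheory.Automorphic

namespace UnitaryGroup

-- the Banach algebra structure of `M_n(K_∞)` through which `IsArchSmooth` is defined
open scoped Matrix.Norms.Operator

variable {F E : Type} [Field F] [NumberField F] [Field E] [NumberField E] [Algebra F E] {c : E ≃ₐ[F] E}
  (hij : (((0 : Fin 2) : ℕ)) + 1 = ((1 : Fin 2) : ℕ)) (hN : 2 = 2 * ((0 : Fin 2) : ℕ) + 2)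

/-! ## The line function is a Schwartz–Bruhat function on `𝔸_F` -/

section Assembly

variable [Algebra.IsQuadraticExtension F E] {δ : E}
  {KU : Subgroup (quasiSplit F E c 2).Adelic} [MeasurableSpace KU] [BorelSpace KU]

/-- **`ψ^K ∘ θ ∈ 𝒮(𝔸_F)` FOR `U(J₂)`** (Rogawski (1990), Prop. 7.3.1 (pp. 97–98): the function of the unipotent term, `K`-average inside, read
on `𝔸_F` through the line `θ`). For `f ∈ C_c^∞(U(J₂)(𝔸_F))`, `K ≤ G(𝔸_F)` compact with a finite Borel measure `μK`, any `z ∈ G(𝔸_F)`: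
`t ↦ ∫_K f(k⁻¹ (z n(θ t)) k) dμK ∈ Meyer.schwartzBruhatAdele F`. Weil's criterion ★ `Meyer.mem_schwartzBruhatAdele_of_level (K := F)`: support
§1; level: `θ` additive, `n(b + b′) = n(b) n(b′)`, the conjugates `k⁻¹ n(θ(0,δ′)) k` have trivial archimedean part and lie in the finite level
of `f` for `δ′ ∈ 𝔫𝒪̂_F` (tube lemma §1); archimedean clause §2. [cite: Rogawski1990, §7.3 Prop. 7.3.1 (pp. 97–98)]
[cite: WeilBNT1967, Ch. VII §2, Def. 2 and Prop. 2] -/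
theorem lineKAverage_mem_schwartzBruhatAdele_two (hcδ : c δ = -δ) (hδ : δ ≠ 0) (hK : IsCompact (KU : Set (quasiSplit F E c 2).Adelic))
    (μK : Measure KU) [IsFiniteMeasure μK] (z : (quasiSplit F E c 2).Adelic) {f : (quasiSplit F E c 2).Adelic → ℂ}
    (hf : IsQuasiSplitTest F E c 2 f) :
    (fun t : AdeleRing (𝓞 F) F =>
      ∫ k, f ((k : (quasiSplit F E c 2).Adelic)⁻¹ * (z * ((middleRootUnipotent hij hN (Multiplicative.ofAdd
        (traceZeroLine F E c hcδ hδ t)) : adelicUnipotent F E c 2) : (quasiSplit F E c 2).Adelic)) * k) ∂μK) ∈ Meyer.schwartzBruhatAdele F := by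
  have hsm := contDiff_lineKAverage_two hij hN hcδ hδ hK μK z hf
  obtain ⟨η₁, η₂, hη₁, hη₂, hfη⟩ := hf
  have hη : IsSmoothKernelGL 2 E (fun w => (η₁ w : ℂ) + (η₂ w : ℂ) * Complex.I) := isSmoothKernelGL_of_isTestFunctionGL_pair hη₁ hη₂
  have hfc : HasCompactSupport f := by
    have h : f = (fun w => (η₁ w : ℂ) + (η₂ w : ℂ) * Complex.I) ∘ adelicVal F E c 2 _ := funext hfη
    rw [h]
    have hcl : IsClosed ((adelic F E c 2 ((StdForm.antidiagonal 2).over E) : Subgroup (GL (Fin 2) (AdeleRing (𝓞 E) E))) :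
        Set (GL (Fin 2) (AdeleRing (𝓞 E) E))) := isClosed_unitaryGroupOfForm_conjAdele F E c _
    exact hη.hasCompactSupport.comp_isClosedEmbedding hcl.isClosedEmbedding_subtypeVal
  set nA : traceZeroAdele F E c → (quasiSplit F E c 2).Adelic := fun b =>
    ((middleRootUnipotent hij hN (Multiplicative.ofAdd b) : adelicUnipotent F E c 2) : (quasiSplit F E c 2).Adelic) with hnA
  set Ψ : AdeleRing (𝓞 F) F → ℂ := fun t =>
    ∫ k, f ((k : (quasiSplit F E c 2).Adelic)⁻¹ * (z * nA (traceZeroLine F E c hcδ hδ t)) * k) ∂μK with hΨdef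
  -- (a)/(hcs): supports
  obtain ⟨W_c, hW_c, hW⟩ := exists_isCompact_lineKernel_conj_support_two hij hN hK z hfc
  have hΨ0 : ∀ t, Ψ t ≠ 0 → t ∈ (traceZeroLine F E c hcδ hδ).symm '' W_c := by
    intro t ht
    by_contra hnot
    apply ht
    have h0 : ∀ k : KU, f ((k : (quasiSplit F E c 2).Adelic)⁻¹ * (z * nA (traceZeroLine F E c hcδ hδ t)) *
        (k : (quasiSplit F E c 2).Adelic)) = 0 := by
      intro k
      by_contra hne
      exact hnot ⟨traceZeroLine F E c hcδ hδ t, hW k k.2 _ hne, (traceZeroLine F E c hcδ hδ).symm_apply_apply t⟩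
    show (∫ k, f ((k : (quasiSplit F E c 2).Adelic)⁻¹ * (z * nA (traceZeroLine F E c hcδ hδ t)) * k) ∂μK) = 0
    simp_rw [h0, integral_zero]
  have hTc : IsCompact ((traceZeroLine F E c hcδ hδ).symm '' W_c) := hW_c.image (traceZeroLine F E c hcδ hδ).symm.continuous
  -- (b): the level along the line
  obtain ⟨U, hU, hηU⟩ := hη.exists_level
  obtain ⟨U₀, hU₀o, -, rfl⟩ := hU
  set Uo : Set (quasiSplit F E c 2).Adelic := {v | GLn.sndHom 2 E (adelicVal F E c 2 _ v) ∈ U₀} with hUo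
  have hUoo : IsOpen Uo := hU₀o.preimage (GLn.continuous_sndHom.comp continuous_subtype_val)
  have hUo1 : (1 : (quasiSplit F E c 2).Adelic) ∈ Uo := by
    show GLn.sndHom 2 E (adelicVal F E c 2 _ 1) ∈ U₀
    rw [map_one, map_one]
    exact U₀.one_mem
  obtain ⟨𝔫, -, h𝔫⟩ := exists_levelIdeal_forall_conj_line_traceZeroLine_mem_two hij hN hcδ hδ hK hUoo hUo1
  have hlevel : ∀ δ' ∈ levelIdeal F 𝔫, ∀ (k : KU) (g : (quasiSplit F E c 2).Adelic),
      f ((k : (quasiSplit F E c 2).Adelic)⁻¹ * (g * nA (traceZeroLine F E c hcδ hδ ((((0 : InfiniteAdeleRing F), δ') : AdeleRing (𝓞 F) F)))) *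
        (k : (quasiSplit F E c 2).Adelic)) =
        f ((k : (quasiSplit F E c 2).Adelic)⁻¹ * g * (k : (quasiSplit F E c 2).Adelic)) := by
    intro δ' hδ' k g
    set n' := nA (traceZeroLine F E c hcδ hδ ((((0 : InfiniteAdeleRing F), δ') : AdeleRing (𝓞 F) F))) with hn'
    have hsplit : (k : (quasiSplit F E c 2).Adelic)⁻¹ * (g * n') * (k : (quasiSplit F E c 2).Adelic) =
        ((k : (quasiSplit F E c 2).Adelic)⁻¹ * g * (k : (quasiSplit F E c 2).Adelic)) *
          ((k : (quasiSplit F E c 2).Adelic)⁻¹ * n' * (k : (quasiSplit F E c 2).Adelic)) := by group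
    have hmem : adelicVal F E c 2 _ ((k : (quasiSplit F E c 2).Adelic)⁻¹ * n' * (k : (quasiSplit F E c 2).Adelic)) ∈
        U₀.map (GLn.ofFinite 2 E) := by
      have hf' : GLn.sndHom 2 E (adelicVal F E c 2 _ ((k : (quasiSplit F E c 2).Adelic)⁻¹ * n' * (k : (quasiSplit F E c 2).Adelic))) ∈ U₀ :=
        h𝔫 δ' hδ' k k.2
      have hinf : GLn.toMixed 2 E (adelicVal F E c 2 _ ((k : (quasiSplit F E c 2).Adelic)⁻¹ * n' * (k : (quasiSplit F E c 2).Adelic))) = 1 := by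
        have h0 : archHom E (((traceZeroLine F E c hcδ hδ) ((((0 : InfiniteAdeleRing F), δ') : AdeleRing (𝓞 F) F)) :
            traceZeroAdele F E c) : AdeleRing (𝓞 E) E) = 0 := by
          rw [archHom_apply]
          show InfiniteAdeleRing.ringEquiv_mixedSpace E (InfiniteAdeleRing.baseChange F E 0 *
            (algebraMap E (AdeleRing (𝓞 E) E) δ).1) = 0
          rw [map_zero, zero_mul, map_zero]
        have hnv : ((GLn.toMixed 2 E (adelicVal F E c 2 _ n') : GL (Fin 2) (mixedSpace E)) : Matrix (Fin 2) (Fin 2) (mixedSpace E)) = 1 := by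
          have h := coe_toMixed_adelicVal_middleRootUnipotent_two hij hN
            (traceZeroLine F E c hcδ hδ ((((0 : InfiniteAdeleRing F), δ') : AdeleRing (𝓞 F) F)))
          rw [h0, Matrix.single_zero, add_zero] at h
          exact h
        have hn1 : GLn.toMixed 2 E (adelicVal F E c 2 _ n') = 1 := Units.ext hnv
        simp only [map_mul, map_inv, hn1, mul_one, inv_mul_cancel]
      rw [Subgroup.mem_map]
      refine ⟨GLn.sndHom 2 E (adelicVal F E c 2 _ ((k : (quasiSplit F E c 2).Adelic)⁻¹ * n' * (k : (quasiSplit F E c 2).Adelic))), hf', ?_⟩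
      have hX := GLn.ofInfinite_toMixed_mul_ofFinite_sndHom
        (adelicVal F E c 2 _ ((k : (quasiSplit F E c 2).Adelic)⁻¹ * n' * (k : (quasiSplit F E c 2).Adelic)))
      rw [hinf, map_one, one_mul] at hX
      exact hX
    rw [hsplit, hfη, hfη ((k : (quasiSplit F E c 2).Adelic)⁻¹ * g * (k : (quasiSplit F E c 2).Adelic)),
      map_mul (adelicVal F E c 2 _) ((k : (quasiSplit F E c 2).Adelic)⁻¹ * g * (k : (quasiSplit F E c 2).Adelic))
        ((k : (quasiSplit F E c 2).Adelic)⁻¹ * n' * (k : (quasiSplit F E c 2).Adelic))]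
    exact hηU _ hmem _
  have hinv : ∀ (ti : InfiniteAdeleRing F) (y : FiniteAdeleRing (𝓞 F) F), ∀ δ' ∈ levelIdeal F 𝔫,
      Ψ (ti, y + δ') = Ψ (ti, y) := by
    intro ti y δ' hδ'
    set b₁ : AdeleRing (𝓞 F) F := (((ti, y) : AdeleRing (𝓞 F) F)) with hb₁
    set b₂ : AdeleRing (𝓞 F) F := ((((0 : InfiniteAdeleRing F), δ') : AdeleRing (𝓞 F) F)) with hb₂
    have hsplit : (((ti, y + δ') : AdeleRing (𝓞 F) F)) = b₁ + b₂ := Prod.ext (add_zero _).symm rfl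
    have hn : z * nA (traceZeroLine F E c hcδ hδ (((ti, y + δ') : AdeleRing (𝓞 F) F))) =
        (z * nA (traceZeroLine F E c hcδ hδ b₁)) * nA (traceZeroLine F E c hcδ hδ b₂) := by
      rw [hsplit, map_add]
      show z * ((middleRootUnipotent hij hN (Multiplicative.ofAdd (traceZeroLine F E c hcδ hδ b₁ + traceZeroLine F E c hcδ hδ b₂)) :
          adelicUnipotent F E c 2) : (quasiSplit F E c 2).Adelic) =
        z * ((middleRootUnipotent hij hN (Multiplicative.ofAdd (traceZeroLine F E c hcδ hδ b₁)) : adelicUnipotent F E c 2) :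
          (quasiSplit F E c 2).Adelic) *
          ((middleRootUnipotent hij hN (Multiplicative.ofAdd (traceZeroLine F E c hcδ hδ b₂)) : adelicUnipotent F E c 2) :
            (quasiSplit F E c 2).Adelic)
      rw [coe_middleRootUnipotent_add_two hij hN, mul_assoc]
    show (∫ k, f ((k : (quasiSplit F E c 2).Adelic)⁻¹ * (z * nA (traceZeroLine F E c hcδ hδ (((ti, y + δ') : AdeleRing (𝓞 F) F)))) * k) ∂μK) =
      ∫ k, f ((k : (quasiSplit F E c 2).Adelic)⁻¹ * (z * nA (traceZeroLine F E c hcδ hδ b₁)) * k) ∂μK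
    refine congrArg (fun φ : KU → ℂ => ∫ k, φ k ∂μK) (funext fun k => ?_)
    show f ((k : (quasiSplit F E c 2).Adelic)⁻¹ * (z * nA (traceZeroLine F E c hcδ hδ (((ti, y + δ') : AdeleRing (𝓞 F) F)))) * k) =
      f ((k : (quasiSplit F E c 2).Adelic)⁻¹ * (z * nA (traceZeroLine F E c hcδ hδ b₁)) * k)
    rw [hn, hlevel δ' hδ' k]
  -- assemble Weil's criterion on `𝔸_F`
  refine Meyer.mem_schwartzBruhatAdele_of_level (hTc.image continuous_snd) (fun t ht => ⟨t, hΨ0 t ht, rfl⟩)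
    (isOpen_levelIdeal 𝔫) (isCompact_levelIdeal 𝔫) hinv hsm (fun y => ?_)
  refine HasCompactSupport.of_support_subset_isCompact
    ((hTc.image continuous_fst).image (continuous_ringEquiv_mixedSpace (K := F))) fun s hs => ?_
  have ht : ((((InfiniteAdeleRing.ringEquiv_mixedSpace F).symm s, y) : AdeleRing (𝓞 F) F)) ∈ (traceZeroLine F E c hcδ hδ).symm '' W_c :=
    hΨ0 _ hs
  exact ⟨(InfiniteAdeleRing.ringEquiv_mixedSpace F).symm s, ⟨_, ht, rfl⟩, (InfiniteAdeleRing.ringEquiv_mixedSpace F).apply_symm_apply s⟩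

end Assembly

end UnitaryGroup

end Literature.NumberTheory.Automorphic
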